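import Literature.MathematicalPhysics.QuantumFieldTheory.Balaban1983to89.B13Core214HolomorphicPrimitive
import Literature.MathematicalPhysics.QuantumFieldTheory.Balaban1983to89.B13CauchyDecayPoly

/-!
# `Balaban1983to89.B13Bound226LocatedPoly` — T. Bałaban, *Renormalization group approach to lattice gauge field theories. II.
Cluster expansions*, Commun. Math. Phys. **116** (1988) 1–22 [Balaban1988RG2Cluster], pp. 15–17: the located (2.26)
capstone of the tree at PRINT'S PER-DOMAIN τ-RADII (2.18), with and without the regularity hypotheses `hΨσ`, `hΨτ`

statement-level skeleton of published theorems with citation tags; proofs where landed; nothing here is a claim about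
the Yang–Mills mass gap

WHY (cell `pub-balaban-gaps`, seat ne5 gen 6; cell records (x8), X-H4-1).  (2.18) p. 16 chooses the radius of analyticity in
`τ(Y)` PER DOMAIN, `|τ(Y)| ∝ exp((1 − 3δ)κd_k(Y))`, and (2.20) is the domination of the interaction for `|τ(Y)|` up to THAT
radius.  The tree's capstone `B13Bound226Located.norm_term214_le_226_of_primitives` types the τ-holomorphy with ONE open set
`Uτ ⊇` every closed disc (`B13Term214.SepHolOn Uτ`), so deriving its `hΨτ` needs (2.20) on the cube `Uτ^𝐃`, i.e. at the
uniform radius `max_Y |τ(Y)|` — torus-size dependent (`B13Core214HolomorphicCapstone`, one finite torus).  Here the τ-data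
are in the per-coordinate class `B13CauchyDecayPoly.SepHolOnPoly (Uτ : κ → Set ℂ)`: open regions `Uτ Y ⊇ {|z| ≤ R_τ(Y)}`, and
(2.20) on `Π_Y Uτ Y` (e.g. the open discs of radii `(1+ε)R_τ(Y)`: print's (2.20) with `(a, w)` inflated by `1+ε`) — uniform
in the torus.

CONTENT.  §1 `sepHolOnPoly_core214_tau` — the τ-slot in the poly class from the generic (2.15)–(2.23) letters at a fixed σ
(`B13Core214Holomorphic.differentiableOn_core214X` on the open set `Π_Y Uτ Y`).  §2 `sepHolOnPoly_core214_tau_of_primitives` —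
the same from the capstone's primitive data at a σ of the open σ-polydisc.  §3 `norm_term214_le_226_of_primitives_polyτ` — the
located capstone WITH the letters `hΨσ`, `hΨτ : SepHolOnPoly Uτ` (`B13CauchyDecayPoly.norm_term214_le_215_polyτ` ×
`B13Bound226Located.norm_core214_F214_le_K_of_216`; same conclusion and constants as the tree's capstone).  §4
`norm_term214_le_226_of_primitives_holo_polyτ` — the located capstone WITHOUT `hΨσ`, `hΨτ` (σ-slot by
`B13Core214HolomorphicPrimitive.sepHolOn_core214_sigma_of_primitives`, τ-slot by §2; the capstone's `h220R` is the point
`τ = (R_τ(Y))_Y` of the region and is derived from `h220U`).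

HONEST FRAMING.  Generic finite-dimensional complex analysis over the block model; every kernel family and letter is a
HYPOTHESIS; nothing of Bałaban's constructed; (D4) 0∕1, spine 0∕9 UNCHANGED; NOT continuum, NOT mass gap, NOT Clay.
0 sorry, 0 `def`.
-/

noncomputable section

namespace Literature.MathematicalPhysics.QuantumFieldTheory.Balaban1983to89.B13Bound226LocatedPoly

open Matrix MeasureTheory Finset Complex Metric Set
open scoped Real
open B13PerturbativeStep (WeightHyp)
open B13Term214 (core214 F214 SepHolOn term214 integrand214 cgaussMean)
open B13Eq216FirstForm (hdef1_of_linear)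
open B13Bound226Primitive (hdef3_of_linear h216R3_of_diff continuous_of_linear)
open B13Bound226Located (h216R1_of_factors hR1_of_entrywise hR2_of_entrywise hR3_of_entrywise h17a_of_entrywise
  h17b_of_entrywise entry_bound_mono_rate norm_core214_F214_le_K_of_216)
open B13Integral223 (norm_F214_le posDef_inv_sub_smul)
open B13Replacement223 (integrable_integrand223)
open B13Core214Holomorphic (measurable_F214 differentiableOn_F214 differentiableOn_core214X)
open B13Core214HolomorphicPrimitive (sepHolOn_core214_sigma_of_primitives)
open B13CauchyDecayPoly (SepHolOnPoly sepHolOnPoly_of_differentiableOn norm_term214_le_215_polyτ)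

/-! ## §1. The τ-slot in the poly class, generic letters -/

section Generic

variable {Λ C₀ : Type} [Fintype Λ] [DecidableEq Λ] [Fintype C₀] [DecidableEq C₀]
variable {C : Matrix Λ Λ ℝ} {Γ₀ : Matrix Λ (Λ ⊕ C₀) ℝ} {ρ c g η : ℝ}

/-- **THE τ-SLOT IN THE POLY CLASS, generic letters**: at a fixed `σ` (operators `A(σ)`, `Γ(σ)` fixed, with the
(2.15)–(2.23) letters at that `σ`), for `τ` in the open per-domain region `Π_Y Uτ Y` on which the interaction obeys (2.20)
(`Σ_{Y∈𝐃}|τ(Y)||𝐕_k(Y,B)| ≤ ½a₂₀‖B‖² + w` for `τ Y ∈ Uτ Y` — print: `|τ(Y)|` up to the PER-DOMAIN radius (2.18), e.g.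
`Uτ Y` = the open disc of radius `(1+ε)|τ(Y)|`, torus-uniform) and the characteristic functions obey (2.22), the function
`τ ↦ ∫dμ₀(X)|_Z (lines 2–4 of (2.14))` = `core214 A Γ (F214 …) σ τ` is `SepHolOnPoly Uτ` (`B13Core214Holomorphic.sepHolOn_core214_tau`,
per-domain regions: holomorphy under the integral sign on the open set `Π_Y Uτ Y` by `differentiableOn_core214X`).
[cite: Balaban1988RG2Cluster, (2.14)–(2.15) p.15, (2.16)–(2.22) p.16, (2.23) p.17] -/
theorem sepHolOnPoly_core214_tau {ι : Type*} {D : Type*} [Fintype D] [DecidableEq D] {Uτ : D → Set ℂ}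
    (hU : ∀ Y, IsOpen (Uτ Y))
    {Aσ : (ι → ℂ) → Matrix Λ Λ ℂ} {Γσ : (ι → ℂ) → (Λ ⊕ C₀ → ℝ) → (Λ → ℂ)} (σ : ι → ℂ)
    (hAs : (Aσ σ).IsSymm) (hApos : ((Aσ σ).map Complex.re).PosDef) (hΓc : Continuous (Γσ σ))
    (cardP : ℕ) {χY₀ χcP : (Λ → ℝ) → ℝ} (hχm : Measurable χY₀) (hχcm : Measurable χcP)
    (hχ0 : ∀ B, 0 ≤ χY₀ B) (hχc0 : ∀ B, 0 ≤ χcP B) (Dfam : Finset D) {Vk : D → (Λ → ℝ) → ℂ}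
    (hVm : ∀ Y, Measurable (Vk Y)) {γ₂ rP a₂₀ w : ℝ} (qP : (Λ → ℝ) → ℝ)
    (h222 : ∀ B, χY₀ B * χcP B ≤ Real.exp (-(γ₂ / 2 * rP ^ 2 * cardP) + γ₂ / 2 * qP B)) (hγ₂ : 0 ≤ γ₂)
    (hqP : ∀ B, qP B ≤ B ⬝ᵥ B) (ha₂₀ : 0 ≤ a₂₀)
    (h220U : ∀ τ : D → ℂ, (∀ Y, τ Y ∈ Uτ Y) → ∀ B, ∑ Y ∈ Dfam, ‖τ Y‖ * ‖Vk Y B‖ ≤ a₂₀ / 2 * (B ⬝ᵥ B) + w)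
    (hC : C.PosDef) (hρ0 : 0 ≤ ρ)
    (hR1 : ∀ X : Λ ⊕ C₀ → ℝ, -(1 / 2) * ((Γσ σ X) ⬝ᵥ ((Aσ σ)⁻¹ *ᵥ Γσ σ X)).re
      ≤ -(1 / 2 * ((Γ₀ *ᵥ X) ⬝ᵥ (C *ᵥ (Γ₀ *ᵥ X)))) + ρ / 2 * (X ⬝ᵥ X))
    (h17a : Real.sqrt (‖(Aσ σ).det‖ / ((Aσ σ).map Complex.re).det) ≤ Real.exp (η * Fintype.card Λ))
    (h17b : Real.sqrt (((Aσ σ).map Complex.re).det / C⁻¹.det) ≤ Real.exp (η * Fintype.card Λ))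
    (hR2 : ∀ B : Λ → ℝ, B ⬝ᵥ ((C⁻¹ - (Aσ σ).map Complex.re) *ᵥ B) ≤ ρ * (B ⬝ᵥ B))
    (hR3 : ∀ (X : Λ ⊕ C₀ → ℝ) (B : Λ → ℝ), -(B ⬝ᵥ fun i => (Γσ σ X i).re)
      ≤ -(B ⬝ᵥ (Γ₀ *ᵥ X)) + ρ / 2 * (X ⬝ᵥ X + B ⬝ᵥ B))
    (hc0 : 0 ≤ c) (hc : ∀ k, hC.1.eigenvalues k ≤ c) (hαc : (2 * ρ + (γ₂ + a₂₀)) * c ≤ 1 / 2)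
    (hΓ0 : ∀ X : Λ ⊕ C₀ → ℝ, (Γ₀ *ᵥ X) ⬝ᵥ (C *ᵥ (Γ₀ *ᵥ X)) ≤ g * (X ⬝ᵥ X))
    (hsmall : (2 * ρ + (γ₂ + a₂₀)) * (1 + 2 * c * g) < 1) :
    SepHolOnPoly Uτ (fun τ => core214 Aσ Γσ (F214 cardP χY₀ χcP Dfam Vk) σ τ) := by
  have hV : IsOpen {τ : D → ℂ | ∀ Y, τ Y ∈ Uτ Y} := by
    have e : {τ : D → ℂ | ∀ Y, τ Y ∈ Uτ Y} = Set.pi Set.univ Uτ := by ext τ; simp [Set.mem_pi]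
    rw [e]; exact isOpen_set_pi Set.finite_univ fun Y _ => hU Y
  refine sepHolOnPoly_of_differentiableOn (W := {τ : D → ℂ | ∀ Y, τ Y ∈ Uτ Y}) (fun q hq => hq) ?_
  unfold core214
  refine differentiableOn_core214X (A := fun _ => Aσ σ) (Γ := fun _ => Γσ σ)
    (F := fun τ => F214 cardP χY₀ χcP Dfam Vk τ) (K := Real.exp (-(γ₂ / 2 * rP ^ 2 * cardP) + w)) hV (fun i j => differentiableOn_const _) (fun _ _ => hAs)
    (fun _ _ => hApos) (fun X i => differentiableOn_const _) (fun _ _ => hΓc)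
    (fun B => differentiableOn_F214 cardP χY₀ χcP Dfam Vk _ B)
    (fun τ _ => (measurable_F214 cardP hχm hχcm Dfam hVm τ).stronglyMeasurable) hC hρ0 (by positivity)
    (Real.exp_pos _).le (fun _ _ => hR1) (fun _ _ => h17a) (fun _ _ => h17b) (fun _ _ => hR2) (fun _ _ => hR3)
    (fun τ hτ B => ?_) hc0 hc hαc hΓ0 hsmall
  exact B13Integral223.norm_F214_le cardP χY₀ χcP Dfam Vk τ qP B (hχ0 B) (hχc0 B) (h222 B) hγ₂ (hqP B) (h220U τ hτ B)

end Generic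

/-! ## §2–§4. From the primitive objects, bonds located in an arbitrary site space -/

section Located

variable {S : Type*} [DecidableEq S] {ρ : S → S → ℝ} {Kc : ℝ → ℝ}
variable {Λ : Type} [Fintype Λ] [DecidableEq Λ] {C₀ : Type} [Fintype C₀] [DecidableEq C₀]
variable {ι κ : Type*} [Fintype ι] [DecidableEq ι] [Fintype κ] [DecidableEq κ]

omit [Fintype ι] [DecidableEq ι] in
/-- **THE τ-SLOT FROM THE PRIMITIVE OBJECTS, POLY CLASS, at a σ of the open σ-polydisc** (the letters at that σ by the
capstone's five lines `h216R1_of_factors` → `hR1_of_entrywise`, …; Gaussian growth of the printed last line by `norm_F214_le`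
from (2.22) and (2.20) on the open PER-DOMAIN region `Π_Y Uτ Y`).
[cite: Balaban1988RG2Cluster, (2.14)–(2.15) p.15, (2.16)–(2.22) p.16, (2.23)–(2.25) p.17] -/
theorem sepHolOnPoly_core214_tau_of_primitives (hρ : WeightHyp 0 ρ) (hρs : ∀ x y : S, ρ x y = ρ y x)
    (hKc : ∀ b : ℝ, 0 < b → ∀ (T : Finset S) (x : S), ∑ y ∈ T, Real.exp (-(b * ρ x y)) ≤ Kc b)
    (hKc0 : ∀ b : ℝ, 0 < b → 0 ≤ Kc b)
    {Uτ : κ → Set ℂ} (hUτ : ∀ Y, IsOpen (Uτ Y))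
    (A : (ι → ℂ) → Matrix Λ Λ ℂ) (Γ : (ι → ℂ) → (Λ ⊕ C₀ → ℝ) → (Λ → ℂ)) (G : (ι → ℂ) → Matrix Λ (Λ ⊕ C₀) ℂ)
    (σ : ι → ℂ) (hAs : (A σ).IsSymm) (hA : ((A σ).map Complex.re).PosDef)
    (hlin : ∀ X : Λ ⊕ C₀ → ℝ, Γ σ X = G σ *ᵥ fun j => (X j : ℂ))
    (cardP : ℕ) {χY₀ χcP : (Λ → ℝ) → ℝ} (hχm : Measurable χY₀) (hχcm : Measurable χcP)
    (hχ0 : ∀ B, 0 ≤ χY₀ B) (hχc0 : ∀ B, 0 ≤ χcP B) (Dfam : Finset κ) {V : κ → (Λ → ℝ) → ℂ}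
    (hVm : ∀ Y, Measurable (V Y)) {γ₂ rP a w : ℝ} (qP : (Λ → ℝ) → ℝ)
    (h222 : ∀ B, χY₀ B * χcP B ≤ Real.exp (-(γ₂ / 2 * rP ^ 2 * cardP) + γ₂ / 2 * qP B)) (hγ₂ : 0 ≤ γ₂)
    (hqP : ∀ B, qP B ≤ B ⬝ᵥ B) (ha0 : 0 ≤ a)
    (h220U : ∀ τ : κ → ℂ, (∀ Y, τ Y ∈ Uτ Y) → ∀ B, ∑ Y ∈ Dfam, ‖τ Y‖ * ‖V Y B‖ ≤ a / 2 * (B ⬝ᵥ B) + w)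
    {C : Matrix Λ Λ ℝ} (hC : C.PosDef) (Γ₀ : Matrix Λ (Λ ⊕ C₀) ℝ)
    (locΛ : Λ → S) (locN : Λ ⊕ C₀ → S) {m : ℕ}
    (hfibΛ : ∀ x : S, (Finset.univ.filter fun i => locΛ i = x).card ≤ m)
    (hfibN : ∀ x : S, (Finset.univ.filter fun j => locN j = x).card ≤ m)
    {kap kap' kap'' θ θE θΓ θC KG KΓ KCs K₀ : ℝ} (hkap'' : 0 < kap'') (h1 : kap'' < kap') (h2 : kap' < kap)
    (hθE : 0 ≤ θE) (hθΓ : 0 ≤ θΓ) (hθC : 0 ≤ θC) (hKG : 0 ≤ KG) (hKΓ : 0 ≤ KΓ) (hKCs : 0 ≤ KCs) (hK₀ : 0 ≤ K₀)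
    (hθEle : θE ≤ θ) (hθΓle : θΓ ≤ θ)
    (hθR1le : (m * Kc (kap - kap')) * (m * Kc (kap' - kap''))
      * (θΓ * KCs * KG + KΓ * θC * KG + KΓ * K₀ * θΓ) ≤ θ)
    (hG : ∀ b j, ‖G σ b j‖ ≤ KG * Real.exp (-(kap * ρ (locΛ b) (locN j))))
    (hΓ₀ : ∀ b j, ‖Γ₀ b j‖ ≤ KΓ * Real.exp (-(kap * ρ (locΛ b) (locN j))))
    (hCs : ∀ b b', ‖(A σ)⁻¹ b b'‖ ≤ KCs * Real.exp (-(kap * ρ (locΛ b) (locΛ b'))))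
    (hC216 : ∀ b b', ‖C b b'‖ ≤ K₀ * Real.exp (-(kap * ρ (locΛ b) (locΛ b'))))
    (hdΓ : ∀ b j, ‖(G σ - Γ₀.map (algebraMap ℝ ℂ)) b j‖ ≤ θΓ * Real.exp (-(kap * ρ (locΛ b) (locN j))))
    (hdC : ∀ b b', ‖((A σ)⁻¹ - C.map (algebraMap ℝ ℂ)) b b'‖ ≤ θC * Real.exp (-(kap * ρ (locΛ b) (locΛ b'))))
    (hdE : ∀ b b', ‖(A σ - C⁻¹.map (algebraMap ℝ ℂ)) b b'‖ ≤ θE * Real.exp (-(kap * ρ (locΛ b) (locΛ b'))))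
    (hsmallKθ : K₀ * (m * Kc kap) * (θ * (m * Kc kap'')) < 1)
    {c g : ℝ} (hc0 : 0 ≤ c) (hc : ∀ k, hC.1.eigenvalues k ≤ c)
    (hαc : (2 * (θ * (m * Kc kap'')) + (γ₂ + a)) * c ≤ 1 / 2)
    (hΓq : ∀ X : Λ ⊕ C₀ → ℝ, (Γ₀ *ᵥ X) ⬝ᵥ (C *ᵥ (Γ₀ *ᵥ X)) ≤ g * (X ⬝ᵥ X))
    (hsmall : (2 * (θ * (m * Kc kap'')) + (γ₂ + a)) * (1 + 2 * c * g) ≤ 1 / 2) :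
    SepHolOnPoly Uτ (fun τ => core214 A Γ (F214 cardP χY₀ χcP Dfam V) σ τ) := by
  have hθ : 0 ≤ θ := hθE.trans hθEle
  have hkap : 0 < kap := hkap''.trans (h1.trans h2)
  have hkk : kap'' ≤ kap := (h1.trans h2).le
  have hρ0 : 0 ≤ θ * (m * Kc kap'') := mul_nonneg hθ (mul_nonneg (Nat.cast_nonneg m) (hKc0 _ hkap''))
  have h216R1 : ∀ b b', ‖(Γ₀ᵀ * C * Γ₀ - ((G σ)ᵀ * (A σ)⁻¹ * G σ).map Complex.re) b b'‖
      ≤ θ * Real.exp (-(kap'' * ρ (locN b) (locN b'))) := fun b b' =>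
    (h216R1_of_factors hρ hρs hKc hKc0 hθΓ hθC hKG hKΓ hKCs hK₀ hkap''.le h1 h2 locΛ locN hfibΛ
      hdΓ hdC hG hΓ₀ hCs hC216 b b').trans (mul_le_mul_of_nonneg_right hθR1le (Real.exp_pos _).le)
  have h216E : ∀ b b', ‖(A σ - C⁻¹.map (algebraMap ℝ ℂ)) b b'‖ ≤ θ * Real.exp (-(kap'' * ρ (locΛ b) (locΛ b'))) :=
    fun b b' => (entry_bound_mono_rate hρ hθE hkk locΛ locΛ hdE b b').trans
      (mul_le_mul_of_nonneg_right hθEle (Real.exp_pos _).le)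
  have h216R3 : ∀ i j, ‖((G σ).map Complex.re - Γ₀) i j‖ ≤ θ * Real.exp (-(kap'' * ρ (locΛ i) (locN j))) := by
    have hmono : ∀ i j, ‖(G σ - Γ₀.map (algebraMap ℝ ℂ)) i j‖ ≤ θ * Real.exp (-(kap'' * ρ (locΛ i) (locN j))) :=
      fun i j => (entry_bound_mono_rate hρ hθΓ hkk locΛ locN hdΓ i j).trans
        (mul_le_mul_of_nonneg_right hθΓle (Real.exp_pos _).le)
    exact fun i j => h216R3_of_diff hmono i j
  exact sepHolOnPoly_core214_tau (ρ := θ * (m * Kc kap''))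
    (η := K₀ * (m * Kc kap) * (θ * (m * Kc kap'')) * (1 + (1 - K₀ * (m * Kc kap) * (θ * (m * Kc kap'')))⁻¹) / 2)
    (g := g) (Γ₀ := Γ₀) hUτ σ hAs hA (continuous_of_linear (G σ) (Γ σ) hlin) cardP hχm hχcm hχ0 hχc0 Dfam hVm qP
    h222 hγ₂ hqP ha0 h220U hC hρ0
    (fun X => hR1_of_entrywise hρ hρs hKc (Γ σ) Γ₀ _ hθ hkap'' locN hfibN
      (hdef1_of_linear (A σ) (G σ) (Γ σ) hlin C Γ₀) h216R1 X)
    (h17a_of_entrywise hρ hρs hKc hC hA hθ hkap'' hK₀ hkap locΛ hfibΛ hC216 h216E hsmallKθ)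
    (h17b_of_entrywise hρ hρs hKc hC hA hθ hkap'' hK₀ hkap locΛ hfibΛ hC216 h216E hsmallKθ)
    (fun B => hR2_of_entrywise hρ hρs hKc hθ hkap'' locΛ hfibΛ h216E B)
    (fun X B => hR3_of_entrywise hρs hKc (Γ σ) Γ₀ _ hθ hkap'' locΛ locN hfibΛ hfibN
      (hdef3_of_linear (G σ) (Γ σ) hlin Γ₀) h216R3 X B)
    hc0 hc hαc hΓq (lt_of_le_of_lt hsmall (by norm_num))

omit [Fintype ι] [Fintype κ] in
/-- **(2.26) FOR THE TYPED TERM (2.14) FROM THE PRIMITIVE OBJECTS, PER-DOMAIN τ-REGIONS** — the tree's capstone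
`B13Bound226Located.norm_term214_le_226_of_primitives` with its τ-data in the poly class: open regions `Uτ Y ⊇ {|z| ≤ R_τ(Y)}`
(one per domain `Y`, each containing the contour discs), `hΨσ` for the τ of `Π_Y Uτ Y`, `hΨτ : SepHolOnPoly Uτ`; every other
hypothesis, the conclusion and every constant IDENTICAL (`B13CauchyDecayPoly.norm_term214_le_215_polyτ` ×
`B13Bound226Located.norm_core214_F214_le_K_of_216`, with `R₁ := Γ₀ᵀCΓ₀ − Re(G(σ)ᵀA(σ)⁻¹G(σ))`, `R₃ := Re G(σ) − Γ₀` and the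
capstone's three entrywise lines). [cite: Balaban1988RG2Cluster, (2.14)–(2.15) p.15, (2.16)–(2.22) p.16, (2.23)–(2.26) p.17] -/
theorem norm_term214_le_226_of_primitives_polyτ (hρ : WeightHyp 0 ρ) (hρs : ∀ x y : S, ρ x y = ρ y x)
    (hKc : ∀ b : ℝ, 0 < b → ∀ (T : Finset S) (x : S), ∑ y ∈ T, Real.exp (-(b * ρ x y)) ≤ Kc b)
    (hKc0 : ∀ b : ℝ, 0 < b → 0 ≤ Kc b)
    {κ₁ : ℝ} (hκ₁ : 1 ≤ κ₁) (Rτ : κ → ℝ) (hRτ : ∀ Y, 2 ≤ Rτ Y)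
    {Uσ : Set ℂ} {Uτ : κ → Set ℂ} (hUσ : IsOpen Uσ) (hUτ : ∀ Y, IsOpen (Uτ Y))
    (hUexp : closedBall (0 : ℂ) (Real.exp κ₁) ⊆ Uσ) (hUtau : ∀ Y, closedBall (0 : ℂ) (Rτ Y) ⊆ Uτ Y)
    {r : ℝ} (hr : 0 < r) (hr' : r ≤ Real.exp κ₁ - 1)
    (hsubτ : ∀ Y, ∀ s ∈ Set.uIcc (0 : ℝ) 1, closedBall (s : ℂ) r ⊆ Uτ Y)
    (A : (ι → ℂ) → Matrix Λ Λ ℂ) (Γ : (ι → ℂ) → (Λ ⊕ C₀ → ℝ) → (Λ → ℂ))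
    (cardP : ℕ) (χY₀ χcP : (Λ → ℝ) → ℝ) (hχ0 : ∀ B, 0 ≤ χY₀ B) (hχc0 : ∀ B, 0 ≤ χcP B) (Dfam : Finset κ)
    (V : κ → (Λ → ℝ) → ℂ)
    (hΨσ : ∀ τ : κ → ℂ, (∀ j, τ j ∈ Uτ j) → SepHolOn Uσ (fun σ => core214 A Γ (F214 cardP χY₀ χcP Dfam V) σ τ))
    (hΨτ : ∀ σ : ι → ℂ, (∀ j, σ j ∈ Uσ) → SepHolOnPoly Uτ (fun τ => core214 A Γ (F214 cardP χY₀ χcP Dfam V) σ τ))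
    {C : Matrix Λ Λ ℝ} (hC : C.PosDef) (Γ₀ : Matrix Λ (Λ ⊕ C₀) ℝ)
    (hAs : ∀ σ : ι → ℂ, (∀ j, ‖σ j‖ ≤ Real.exp κ₁) → (A σ).IsSymm)
    (hA : ∀ σ : ι → ℂ, (∀ j, ‖σ j‖ ≤ Real.exp κ₁) → ((A σ).map Complex.re).PosDef)
    -- the Γ-operator is linear with kernel G(σ)
    (G : (ι → ℂ) → Matrix Λ (Λ ⊕ C₀) ℂ)
    (hlin : ∀ σ : ι → ℂ, (∀ j, ‖σ j‖ ≤ Real.exp κ₁) → ∀ X : Λ ⊕ C₀ → ℝ, Γ σ X = G σ *ᵥ fun j => (X j : ℂ))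
    {γ₂ rP a w : ℝ} (qP : (Λ → ℝ) → ℝ)
    (h222 : ∀ B, χY₀ B * χcP B ≤ Real.exp (-(γ₂ / 2 * rP ^ 2 * cardP) + γ₂ / 2 * qP B)) (hγ₂ : 0 ≤ γ₂)
    (hqP : ∀ B, qP B ≤ B ⬝ᵥ B) (h220R : ∀ B, ∑ Y ∈ Dfam, Rτ Y * ‖V Y B‖ ≤ a / 2 * (B ⬝ᵥ B) + w) (ha0 : 0 ≤ a)
    -- located bonds
    (locΛ : Λ → S) (locN : Λ ⊕ C₀ → S) {m : ℕ}
    (hfibΛ : ∀ x : S, (Finset.univ.filter fun i => locΛ i = x).card ≤ m)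
    (hfibN : ∀ x : S, (Finset.univ.filter fun j => locN j = x).card ≤ m)
    -- rates and constants
    {kap kap' kap'' θ θE θΓ θC KG KΓ KCs K₀ : ℝ} (hkap'' : 0 < kap'') (h1 : kap'' < kap') (h2 : kap' < kap)
    (hθE : 0 ≤ θE) (hθΓ : 0 ≤ θΓ) (hθC : 0 ≤ θC) (hKG : 0 ≤ KG) (hKΓ : 0 ≤ KΓ) (hKCs : 0 ≤ KCs) (hK₀ : 0 ≤ K₀)
    (hθEle : θE ≤ θ) (hθΓle : θΓ ≤ θ)
    (hθR1le : (m * Kc (kap - kap')) * (m * Kc (kap' - kap''))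
      * (θΓ * KCs * KG + KΓ * θC * KG + KΓ * K₀ * θΓ) ≤ θ)
    -- uniform localisation of the primitive kernels (L17a)
    (hG : ∀ σ : ι → ℂ, (∀ j, ‖σ j‖ ≤ Real.exp κ₁) →
      ∀ b j, ‖G σ b j‖ ≤ KG * Real.exp (-(kap * ρ (locΛ b) (locN j))))
    (hΓ₀ : ∀ b j, ‖Γ₀ b j‖ ≤ KΓ * Real.exp (-(kap * ρ (locΛ b) (locN j))))
    (hCs : ∀ σ : ι → ℂ, (∀ j, ‖σ j‖ ≤ Real.exp κ₁) →
      ∀ b b', ‖(A σ)⁻¹ b b'‖ ≤ KCs * Real.exp (-(kap * ρ (locΛ b) (locΛ b'))))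
    (hC216 : ∀ b b', ‖C b b'‖ ≤ K₀ * Real.exp (-(kap * ρ (locΛ b) (locΛ b'))))
    -- the (2.16)-type differences of the primitive kernels (L16a)
    (hdΓ : ∀ σ : ι → ℂ, (∀ j, ‖σ j‖ ≤ Real.exp κ₁) →
      ∀ b j, ‖(G σ - Γ₀.map (algebraMap ℝ ℂ)) b j‖ ≤ θΓ * Real.exp (-(kap * ρ (locΛ b) (locN j))))
    (hdC : ∀ σ : ι → ℂ, (∀ j, ‖σ j‖ ≤ Real.exp κ₁) →
      ∀ b b', ‖((A σ)⁻¹ - C.map (algebraMap ℝ ℂ)) b b'‖ ≤ θC * Real.exp (-(kap * ρ (locΛ b) (locΛ b'))))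
    (hdE : ∀ σ : ι → ℂ, (∀ j, ‖σ j‖ ≤ Real.exp κ₁) →
      ∀ b b', ‖(A σ - C⁻¹.map (algebraMap ℝ ℂ)) b b'‖ ≤ θE * Real.exp (-(kap * ρ (locΛ b) (locΛ b'))))
    (hsmallKθ : K₀ * (m * Kc kap) * (θ * (m * Kc kap'')) < 1)
    -- the (2.24)–(2.25) smallness
    {c g : ℝ} (hc0 : 0 ≤ c) (hc : ∀ k, hC.1.eigenvalues k ≤ c)
    (hαc : (2 * (θ * (m * Kc kap'')) + (γ₂ + a)) * c ≤ 1 / 2) (hg : 0 ≤ g)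
    (hΓq : ∀ X : Λ ⊕ C₀ → ℝ, (Γ₀ *ᵥ X) ⬝ᵥ (C *ᵥ (Γ₀ *ᵥ X)) ≤ g * (X ⬝ᵥ X))
    (hsmall : (2 * (θ * (m * Kc kap'')) + (γ₂ + a)) * (1 + 2 * c * g) ≤ 1 / 2)
    {lZ : List ι} (hlZ : lZ.Nodup) {lD : List κ} (hlD : lD.Nodup)
    {σ₀ : ι → ℂ} (hσ₀ : ∀ j, ‖σ₀ j‖ ≤ 1) {τ₀ : κ → ℂ} (hτ₀ : ∀ Y, ‖τ₀ Y‖ ≤ 1) :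
    ‖term214 r lZ lD (core214 A Γ (F214 cardP χY₀ χcP Dfam V)) σ₀ τ₀‖ ≤
      Real.exp (-(κ₁ - 1) * lZ.length) * (∏ Y ∈ lD.toFinset, 2 * (Rτ Y)⁻¹)
        * (Real.exp (2 * (K₀ * (m * Kc kap) * (θ * (m * Kc kap''))
              * (1 + (1 - K₀ * (m * Kc kap) * (θ * (m * Kc kap'')))⁻¹) / 2) * Fintype.card Λ)
          * Real.exp (-(γ₂ / 2 * rP ^ 2 * cardP) + w)
          * (Real.exp ((2 * (θ * (m * Kc kap'')) + (γ₂ + a)) * c * Fintype.card Λ)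
            * Real.exp ((2 * (θ * (m * Kc kap'')) + (γ₂ + a)) * (1 + 2 * c * g)
              * Fintype.card (Λ ⊕ C₀)))) := by
  have hθ : 0 ≤ θ := hθE.trans hθEle
  have hkap : 0 < kap := hkap''.trans (h1.trans h2)
  have hkk : kap'' ≤ kap := (h1.trans h2).le
  -- R₁ and R₃ constructed from the primitive kernels
  -- (2.15)'s Cauchy part, per-domain τ-regions, times the sup bound with (2.16) entrywise (R₁, R₃ constructed)
  refine norm_term214_le_215_polyτ hκ₁ Rτ hRτ hUσ hUτ hUexp hUtau hr hr' hsubτ hΨσ hΨτ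
    (norm_core214_F214_le_K_of_216 hρ hρs hKc hKc0 A Γ hC Γ₀ (fun _ => Real.exp κ₁) Rτ hAs hA
      (fun σ hσ => continuous_of_linear (G σ) (Γ σ) (hlin σ hσ)) cardP χY₀ χcP hχ0 hχc0 Dfam V qP h222 hγ₂ hqP
      h220R ha0 hθ hkap'' hK₀ hkap locΛ locN hfibΛ hfibN
      (fun σ => Γ₀ᵀ * C * Γ₀ - ((G σ)ᵀ * (A σ)⁻¹ * G σ).map Complex.re)
      (fun σ => (G σ).map Complex.re - Γ₀)
      (fun σ hσ X => hdef1_of_linear (A σ) (G σ) (Γ σ) (hlin σ hσ) C Γ₀ X)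
      (fun σ hσ b b' => ?_) (fun σ hσ b b' => ?_)
      (fun σ hσ X i => hdef3_of_linear (G σ) (Γ σ) (hlin σ hσ) Γ₀ X i)
      (fun σ hσ i j => ?_) hC216 hsmallKθ hc0 hc hαc hg hΓq hsmall)
    hlZ hlD hσ₀ hτ₀
  · -- h216R1: from the factor bounds, then to the common majorant θ
    have h := h216R1_of_factors hρ hρs hKc hKc0 hθΓ hθC hKG hKΓ hKCs hK₀ hkap''.le h1 h2 locΛ locN hfibΛ
      (hdΓ σ hσ) (hdC σ hσ) (hG σ hσ) hΓ₀ (hCs σ hσ) hC216 b b'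
    exact h.trans (mul_le_mul_of_nonneg_right hθR1le (Real.exp_pos _).le)
  · -- h216E: rate κ → κ″, constant θ_E → θ
    have h := entry_bound_mono_rate hρ hθE hkk locΛ locΛ (hdE σ hσ) b b'
    exact h.trans (mul_le_mul_of_nonneg_right hθEle (Real.exp_pos _).le)
  · -- h216R3: from G(σ) − Γ₀, rate κ → κ″, constant θ_Γ → θ
    have hmono : ∀ i j, ‖(G σ - Γ₀.map (algebraMap ℝ ℂ)) i j‖
        ≤ θ * Real.exp (-(kap'' * ρ (locΛ i) (locN j))) := fun i j =>
      (entry_bound_mono_rate hρ hθΓ hkk locΛ locN (hdΓ σ hσ) i j).trans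
        (mul_le_mul_of_nonneg_right hθΓle (Real.exp_pos _).le)
    exact h216R3_of_diff hmono i j

/-- **(2.26) FOR THE TYPED TERM (2.14) FROM THE PRIMITIVE OBJECTS, PER-DOMAIN τ-REGIONS, WITHOUT THE REGULARITY HYPOTHESES
`hΨσ`, `hΨτ`** — `norm_term214_le_226_of_primitives_polyτ` with both slots DERIVED: the σ-letters on the OPEN σ-polydisc
`{σ | ∀ j, σ j ∈ Uσ}` (⊇ the closed `e^{κ₁}`-ball), entrywise holomorphy of `A(σ)`, `G(σ)` there, measurability of `χ_{k,Y₀}`,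
`χᶜ_{k,P}`, `𝐕_k(Y,·)`, and (2.20) on the open PER-DOMAIN region `Π_Y Uτ Y` (`h220U`; it contains the capstone's `h220R` at the
radii `R_τ(Y)`, derived inside) — print's per-domain radii (2.18), torus-uniform (cell records (x8), X-H4-1).  Same
conclusion, same constants. [cite: Balaban1988RG2Cluster, (2.14)–(2.15) p.15, (2.16)–(2.22) p.16, (2.23)–(2.26) p.17] -/
theorem norm_term214_le_226_of_primitives_holo_polyτ (hρ : WeightHyp 0 ρ) (hρs : ∀ x y : S, ρ x y = ρ y x)
    (hKc : ∀ b : ℝ, 0 < b → ∀ (T : Finset S) (x : S), ∑ y ∈ T, Real.exp (-(b * ρ x y)) ≤ Kc b)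
    (hKc0 : ∀ b : ℝ, 0 < b → 0 ≤ Kc b)
    {κ₁ : ℝ} (hκ₁ : 1 ≤ κ₁) (Rτ : κ → ℝ) (hRτ : ∀ Y, 2 ≤ Rτ Y)
    {Uσ : Set ℂ} {Uτ : κ → Set ℂ} (hUσ : IsOpen Uσ) (hUτ : ∀ Y, IsOpen (Uτ Y))
    (hUexp : closedBall (0 : ℂ) (Real.exp κ₁) ⊆ Uσ) (hUtau : ∀ Y, closedBall (0 : ℂ) (Rτ Y) ⊆ Uτ Y)
    {r : ℝ} (hr : 0 < r) (hr' : r ≤ Real.exp κ₁ - 1)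
    (hsubτ : ∀ Y, ∀ s ∈ Set.uIcc (0 : ℝ) 1, closedBall (s : ℂ) r ⊆ Uτ Y)
    (A : (ι → ℂ) → Matrix Λ Λ ℂ) (Γ : (ι → ℂ) → (Λ ⊕ C₀ → ℝ) → (Λ → ℂ))
    (cardP : ℕ) (χY₀ χcP : (Λ → ℝ) → ℝ) (hχ0 : ∀ B, 0 ≤ χY₀ B) (hχc0 : ∀ B, 0 ≤ χcP B) (Dfam : Finset κ)
    (V : κ → (Λ → ℝ) → ℂ)
    {C : Matrix Λ Λ ℝ} (hC : C.PosDef) (Γ₀ : Matrix Λ (Λ ⊕ C₀) ℝ)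
    -- replaces hΨσ ∕ hΨτ: entrywise holomorphy of the primitive kernels on the OPEN σ-polydisc, measurability of the last
    -- line's ingredients, (2.20) on the open PER-DOMAIN τ-region; the σ-letters below on the open σ-polydisc
    (hAhol : ∀ i j, DifferentiableOn ℂ (fun σ => A σ i j) {σ | ∀ j, σ j ∈ Uσ})
    (hχm : Measurable χY₀) (hχcm : Measurable χcP) (hVm : ∀ Y, Measurable (V Y))
    (hAs : ∀ σ : ι → ℂ, (∀ j, σ j ∈ Uσ) → (A σ).IsSymm)
    (hA : ∀ σ : ι → ℂ, (∀ j, σ j ∈ Uσ) → ((A σ).map Complex.re).PosDef)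
    -- the Γ-operator is linear with kernel G(σ)
    (G : (ι → ℂ) → Matrix Λ (Λ ⊕ C₀) ℂ)
    (hGhol : ∀ i j, DifferentiableOn ℂ (fun σ => G σ i j) {σ | ∀ j, σ j ∈ Uσ})
    (hlin : ∀ σ : ι → ℂ, (∀ j, σ j ∈ Uσ) → ∀ X : Λ ⊕ C₀ → ℝ, Γ σ X = G σ *ᵥ fun j => (X j : ℂ))
    {γ₂ rP a w : ℝ} (qP : (Λ → ℝ) → ℝ)
    (h222 : ∀ B, χY₀ B * χcP B ≤ Real.exp (-(γ₂ / 2 * rP ^ 2 * cardP) + γ₂ / 2 * qP B)) (hγ₂ : 0 ≤ γ₂)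
    (hqP : ∀ B, qP B ≤ B ⬝ᵥ B) (ha0 : 0 ≤ a)
    (h220U : ∀ τ : κ → ℂ, (∀ Y, τ Y ∈ Uτ Y) → ∀ B, ∑ Y ∈ Dfam, ‖τ Y‖ * ‖V Y B‖ ≤ a / 2 * (B ⬝ᵥ B) + w)
    -- located bonds
    (locΛ : Λ → S) (locN : Λ ⊕ C₀ → S) {m : ℕ}
    (hfibΛ : ∀ x : S, (Finset.univ.filter fun i => locΛ i = x).card ≤ m)
    (hfibN : ∀ x : S, (Finset.univ.filter fun j => locN j = x).card ≤ m)
    -- rates and constants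
    {kap kap' kap'' θ θE θΓ θC KG KΓ KCs K₀ : ℝ} (hkap'' : 0 < kap'') (h1 : kap'' < kap') (h2 : kap' < kap)
    (hθE : 0 ≤ θE) (hθΓ : 0 ≤ θΓ) (hθC : 0 ≤ θC) (hKG : 0 ≤ KG) (hKΓ : 0 ≤ KΓ) (hKCs : 0 ≤ KCs) (hK₀ : 0 ≤ K₀)
    (hθEle : θE ≤ θ) (hθΓle : θΓ ≤ θ)
    (hθR1le : (m * Kc (kap - kap')) * (m * Kc (kap' - kap''))
      * (θΓ * KCs * KG + KΓ * θC * KG + KΓ * K₀ * θΓ) ≤ θ)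
    -- uniform localisation of the primitive kernels (L17a)
    (hG : ∀ σ : ι → ℂ, (∀ j, σ j ∈ Uσ) →
      ∀ b j, ‖G σ b j‖ ≤ KG * Real.exp (-(kap * ρ (locΛ b) (locN j))))
    (hΓ₀ : ∀ b j, ‖Γ₀ b j‖ ≤ KΓ * Real.exp (-(kap * ρ (locΛ b) (locN j))))
    (hCs : ∀ σ : ι → ℂ, (∀ j, σ j ∈ Uσ) →
      ∀ b b', ‖(A σ)⁻¹ b b'‖ ≤ KCs * Real.exp (-(kap * ρ (locΛ b) (locΛ b'))))
    (hC216 : ∀ b b', ‖C b b'‖ ≤ K₀ * Real.exp (-(kap * ρ (locΛ b) (locΛ b'))))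
    -- the (2.16)-type differences of the primitive kernels (L16a)
    (hdΓ : ∀ σ : ι → ℂ, (∀ j, σ j ∈ Uσ) →
      ∀ b j, ‖(G σ - Γ₀.map (algebraMap ℝ ℂ)) b j‖ ≤ θΓ * Real.exp (-(kap * ρ (locΛ b) (locN j))))
    (hdC : ∀ σ : ι → ℂ, (∀ j, σ j ∈ Uσ) →
      ∀ b b', ‖((A σ)⁻¹ - C.map (algebraMap ℝ ℂ)) b b'‖ ≤ θC * Real.exp (-(kap * ρ (locΛ b) (locΛ b'))))
    (hdE : ∀ σ : ι → ℂ, (∀ j, σ j ∈ Uσ) →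
      ∀ b b', ‖(A σ - C⁻¹.map (algebraMap ℝ ℂ)) b b'‖ ≤ θE * Real.exp (-(kap * ρ (locΛ b) (locΛ b'))))
    (hsmallKθ : K₀ * (m * Kc kap) * (θ * (m * Kc kap'')) < 1)
    -- the (2.24)–(2.25) smallness
    {c g : ℝ} (hc0 : 0 ≤ c) (hc : ∀ k, hC.1.eigenvalues k ≤ c)
    (hαc : (2 * (θ * (m * Kc kap'')) + (γ₂ + a)) * c ≤ 1 / 2) (hg : 0 ≤ g)
    (hΓq : ∀ X : Λ ⊕ C₀ → ℝ, (Γ₀ *ᵥ X) ⬝ᵥ (C *ᵥ (Γ₀ *ᵥ X)) ≤ g * (X ⬝ᵥ X))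
    (hsmall : (2 * (θ * (m * Kc kap'')) + (γ₂ + a)) * (1 + 2 * c * g) ≤ 1 / 2)
    {lZ : List ι} (hlZ : lZ.Nodup) {lD : List κ} (hlD : lD.Nodup)
    {σ₀ : ι → ℂ} (hσ₀ : ∀ j, ‖σ₀ j‖ ≤ 1) {τ₀ : κ → ℂ} (hτ₀ : ∀ Y, ‖τ₀ Y‖ ≤ 1) :
    ‖term214 r lZ lD (core214 A Γ (F214 cardP χY₀ χcP Dfam V)) σ₀ τ₀‖ ≤
      Real.exp (-(κ₁ - 1) * lZ.length) * (∏ Y ∈ lD.toFinset, 2 * (Rτ Y)⁻¹)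
        * (Real.exp (2 * (K₀ * (m * Kc kap) * (θ * (m * Kc kap''))
              * (1 + (1 - K₀ * (m * Kc kap) * (θ * (m * Kc kap'')))⁻¹) / 2) * Fintype.card Λ)
          * Real.exp (-(γ₂ / 2 * rP ^ 2 * cardP) + w)
          * (Real.exp ((2 * (θ * (m * Kc kap'')) + (γ₂ + a)) * c * Fintype.card Λ)
            * Real.exp ((2 * (θ * (m * Kc kap'')) + (γ₂ + a)) * (1 + 2 * c * g)
              * Fintype.card (Λ ⊕ C₀))))  := by
  have hin : ∀ σ : ι → ℂ, (∀ j, ‖σ j‖ ≤ Real.exp κ₁) → ∀ j, σ j ∈ Uσ :=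
    fun σ hσ j => hUexp (mem_closedBall_zero_iff.2 (hσ j))
  have ha2 : 0 ≤ γ₂ + a := add_nonneg hγ₂ ha0
  -- (2.20) at the radii `R_τ(Y)` is the point `τ = (R_τ(Y))_Y` of the per-domain region
  have hR0 : ∀ Y, 0 ≤ Rτ Y := fun Y => by linarith [hRτ Y]
  have h220R : ∀ B, ∑ Y ∈ Dfam, Rτ Y * ‖V Y B‖ ≤ a / 2 * (B ⬝ᵥ B) + w := by
    intro B
    have e : ∀ Y, ‖((Rτ Y : ℝ) : ℂ)‖ = Rτ Y := fun Y => by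
      rw [Complex.norm_real, Real.norm_of_nonneg (hR0 Y)]
    have h := h220U (fun Y => ((Rτ Y : ℝ) : ℂ))
      (fun Y => hUtau Y (mem_closedBall_zero_iff.2 (by rw [e Y]))) B
    simpa only [e] using h
  refine norm_term214_le_226_of_primitives_polyτ hρ hρs hKc hKc0 hκ₁ Rτ hRτ hUσ hUτ hUexp hUtau hr hr' hsubτ A Γ cardP χY₀
    χcP hχ0 hχc0 Dfam V (fun τ hτ => ?_) (fun σ hσ => ?_) hC Γ₀ (fun σ hσ => hAs σ (hin σ hσ))
    (fun σ hσ => hA σ (hin σ hσ)) G (fun σ hσ => hlin σ (hin σ hσ)) qP h222 hγ₂ hqP h220R ha0 locΛ locN hfibΛ hfibN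
    hkap'' h1 h2 hθE hθΓ hθC hKG hKΓ hKCs hK₀ hθEle hθΓle hθR1le (fun σ hσ => hG σ (hin σ hσ)) hΓ₀
    (fun σ hσ => hCs σ (hin σ hσ)) hC216 (fun σ hσ => hdΓ σ (hin σ hσ)) (fun σ hσ => hdC σ (hin σ hσ))
    (fun σ hσ => hdE σ (hin σ hσ)) hsmallKθ hc0 hc hαc hg hΓq hsmall hlZ hlD hσ₀ hτ₀
  · -- the σ-slot at this τ
    exact sepHolOn_core214_sigma_of_primitives hρ hρs hKc hKc0 hUσ A Γ G hAhol hGhol hAs hA hlin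
      (F214 cardP χY₀ χcP Dfam V) τ (measurable_F214 cardP hχm hχcm Dfam hVm τ).stronglyMeasurable
      (K := Real.exp (-(γ₂ / 2 * rP ^ 2 * cardP) + w)) (Real.exp_pos _).le ha2
      (fun B => norm_F214_le cardP χY₀ χcP Dfam V τ qP B (hχ0 B) (hχc0 B) (h222 B) hγ₂ (hqP B) (h220U τ hτ B))
      hC Γ₀ locΛ locN hfibΛ hfibN hkap'' h1 h2 hθE hθΓ hθC hKG hKΓ hKCs hK₀ hθEle hθΓle hθR1le hG hΓ₀ hCs hC216 hdΓ
      hdC hdE hsmallKθ hc0 hc hαc hΓq hsmall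
  · -- the τ-slot at this σ, poly class
    exact sepHolOnPoly_core214_tau_of_primitives hρ hρs hKc hKc0 hUτ A Γ G σ (hAs σ hσ) (hA σ hσ) (hlin σ hσ) cardP hχm
      hχcm hχ0 hχc0 Dfam hVm qP h222 hγ₂ hqP ha0 h220U hC Γ₀ locΛ locN hfibΛ hfibN hkap'' h1 h2 hθE hθΓ hθC hKG hKΓ
      hKCs hK₀ hθEle hθΓle hθR1le (hG σ hσ) hΓ₀ (hCs σ hσ) hC216 (hdΓ σ hσ) (hdC σ hσ) (hdE σ hσ) hsmallKθ hc0 hc hαc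
      hΓq hsmall

end Located

end Literature.MathematicalPhysics.QuantumFieldTheory.Balaban1983to89.B13Bound226LocatedPoly

end
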